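import Mathlib
import HarnessLib

/-!
# Commutative twisting dimension of a coefficient pattern

For a field `k`, a finite index type `ι` and a *coefficient pattern* `c : Equiv.Perm ι → k`, a
**commutative realisation** of `c` is a commutative finite-dimensional `k`-algebra `R`, a matrix
of twists `u : ι → ι → R` and a `k`-linear functional `ℓ : R →ₗ[k] k` with
`ℓ (∏ i, u (σ i) i) = c σ` for every permutation `σ`. The **commutative twisting dimension**
`commTwistDim c` is the least `Module.finrank k R` over all commutative realisations (an `sInf`
over `ℕ`; the set is never empty, `commTwistDim_le_card_perm`).

Meaning (`linearMap_coeff_det_twist`): `ℓ`, applied coefficientwise to the single determinant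
`det (X_{ij} · u_{ij})` over `MvPolynomial (ι × ι) R`, produces `∑_σ sgn(σ) c(σ) ∏ᵢ X_{σ i, i}`;
for the sign pattern `c = sgn` this is the permanent, so `perTwistDim k n` (the sign pattern on
`Fin n`) is the least dimension of a commutative coefficient algebra over which the permanent is
a linear image of one twisted `n × n` determinant. The case `R = k` is Pólya's problem of
converting the permanent into the determinant by affixing signs/scalars to the entries,
impossible for `n ≥ 3` in characteristic `≠ 2` (Pólya 1913, Szegő 1913; Marcus–Minc 1961 for
arbitrary linear maps; Brualdi–Ryser 1991, Thm 7.5.1 and (7.76): `E` converts iff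
`∏ᵢ e_{iπ(i)} = sign π` for all `π`), i.e. `perTwistDim k n ≥ 2` there; commutative ring
extensions as a resource for arithmetic computation are studied by Hrubeš–Yehudayoff 2011 (an
extension of dimension `d` is simulated at cost `poly(d)` per ring operation, Thm 4.2 there).

## Contents
* `commTwistDims c`, `commTwistDim c`, `perTwistDim k n`;
* every realisation, in any universe, bounds `commTwistDim` (`commTwistDim_le_finrank`), and a
  realisation of dimension exactly `commTwistDim c` exists (`exists_finrank_eq_commTwistDim`);
* semisimple upper bound: a linear combination of `card T` transversal product patterns
  `σ ↦ ∏ i, E t (σ i) i` is realised over `T → k` (`commTwistDim_le_card_of_eq_sum`), hence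
  `commTwistDim c ≤ card (Perm ι)` always (`commTwistDim_le_card_perm`);
* `commTwistDim c = 0 ↔ c = 0` and `commTwistDim c ≤ 1 ↔ c` is a scalar multiple of one
  transversal product pattern (`commTwistDim_le_one_iff`);
* monotonicity in `n` (restriction to the permutations of `Fin (n+1)` fixing `0`,
  `commTwistDim_fixZero_le`, `perTwistDim_mono`), sub-additivity under pointwise sums
  (`commTwistDim_add_le`, product algebra), sub-multiplicativity under external tensor of
  patterns on a Young subgroup `Perm ι × Perm κ ≤ Perm (ι ⊕ κ)` (`commTwistDim_sum_le`, tensor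
  product of algebras), invariance under relabelings `σ ↦ π σ ρ` and under reindexing along
  `ι ≃ κ`, monotonicity under Hadamard twisting by a transversal product pattern;
* the determinant formula `linearMap_coeff_det_twist`.

## Sources
* M. Marcus, H. Minc, *On the relation between the determinant and the permanent*,
  Illinois J. Math. 5 (1961) — no scalar twisting for `n ≥ 3`.
* R. A. Brualdi, H. J. Ryser, *Combinatorial Matrix Theory*, CUP 1991, §7.5, Thm 7.5.1.
* P. Hrubeš, A. Yehudayoff, *Arithmetic complexity in ring extensions*, Theory of Computing 7
  (2011), Thm 4.2 (cost of simulating a commutative extension of dimension `d`).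

## Design choices
* `R` ranges over `Type u`, the universe of `k` (for `k = ℂ` literally `R : Type`, the binder
  shape `∃ (R : Type) (_ : CommRing R) (_ : Algebra ℂ R) (_ : Module.Finite ℂ R) (u : Fin n →
  Fin n → R) (ℓ : R →ₗ[ℂ] ℂ), …` used by its requesters); `commTwistDim_le_finrank` accepts a
  realisation in ANY universe (transport to a quotient of `MvPolynomial (Fin m) k`), so no
  generality is lost.
* `Module.Finite k R` is part of the data: without it `Module.finrank` would take the junk value
  `0` on an infinite-dimensional realisation (e.g. a polynomial ring) and the infimum would
  collapse to `0`. With it, `commTwistDim c = 0 ↔ c = 0` (the zero algebra realises exactly the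
  zero pattern, `commTwistDim_eq_zero_iff`).
* The index type is any `Fintype ι` (requesters use `ι = Fin n`); this makes the Young-subgroup
  statement live on `ι ⊕ κ`, transported to `Fin (m + n)` by `commTwistDim_reindex`.
* NOT here: the Grassmann (fermionic) realisation of the sign pattern of dimension
  `Nat.centralBinom n` and the lower bound `perTwistDim k n ≥ 2` for `n ≥ 3`, `char k ≠ 2` —
  both are statement items of the requesting route and are left to its provers.
-/

noncomputable section

open MvPolynomial Finset

namespace Literature.Computability.AlgebraicComplexity

universe u v w w'

variable {k : Type u} [Field k] {ι : Type v} [Fintype ι]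

section Defs

/-- The set of dimensions `Module.finrank k R` of the **commutative realisations** of a
coefficient pattern `c : Equiv.Perm ι → k`: commutative finite-dimensional `k`-algebras `R`
(in the universe of `k`) with twists `u : ι → ι → R` and a functional `ℓ : R →ₗ[k] k` such that
`ℓ (∏ i, u (σ i) i) = c σ` for all `σ`. The case `finrank = 1`, `R = k`, is Pólya's sign-affixing
problem (Brualdi–Ryser 1991, §7.5). [folklore] -/
def commTwistDims (c : Equiv.Perm ι → k) : Set ℕ :=
  {d | ∃ (R : Type u) (_ : CommRing R) (_ : Algebra k R) (_ : Module.Finite k R)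
      (u : ι → ι → R) (ℓ : R →ₗ[k] k),
      Module.finrank k R = d ∧ ∀ σ : Equiv.Perm ι, ℓ (∏ i, u (σ i) i) = c σ}

/-- The **commutative twisting dimension** of a coefficient pattern `c : Equiv.Perm ι → k`: the
least `k`-dimension of a commutative finite-dimensional `k`-algebra `R` admitting twists
`u : ι → ι → R` and a functional `ℓ : R →ₗ[k] k` with `ℓ (∏ i, u (σ i) i) = c σ` for all `σ`
(so that `∑_σ sgn(σ) c(σ) x^σ` is `ℓ` of ONE determinant with entries `x_{ij} u_{ij}`,
`linearMap_coeff_det_twist`). An `sInf` over `ℕ` of a nonempty set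
(`commTwistDim_le_card_perm`). Generalises Pólya's conversion problem (`R = k`; Marcus–Minc 1961,
Brualdi–Ryser 1991 Thm 7.5.1) to commutative coefficient algebras in the sense of
Hrubeš–Yehudayoff 2011. [folklore] -/
def commTwistDim (c : Equiv.Perm ι → k) : ℕ :=
  sInf (commTwistDims c)

/-- The commutative twisting dimension `s(n)` **of the permanent**: that of the sign pattern
`σ ↦ sgn σ` on `Fin n` (a realisation turns one twisted determinant into the permanent,
`linearMap_coeff_det_twist`). Pólya–Szegő–Marcus–Minc: `s(n) ≥ 2` for `n ≥ 3` in
characteristic `≠ 2` (Brualdi–Ryser 1991, Thm 7.5.1; not proved here); in characteristic `2`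
the sign pattern is constant and `s(n) = 1`. [folklore] -/
abbrev perTwistDim (k : Type u) [Field k] (n : ℕ) : ℕ :=
  commTwistDim fun σ : Equiv.Perm (Fin n) => ((Equiv.Perm.sign σ : ℤ) : k)

end Defs

variable (c : Equiv.Perm ι → k)

/-- Unfolding of `commTwistDims`. [folklore] -/
theorem mem_commTwistDims_iff (d : ℕ) :
    d ∈ commTwistDims c ↔ ∃ (R : Type u) (_ : CommRing R) (_ : Algebra k R)
      (_ : Module.Finite k R) (u : ι → ι → R) (ℓ : R →ₗ[k] k),
      Module.finrank k R = d ∧ ∀ σ : Equiv.Perm ι, ℓ (∏ i, u (σ i) i) = c σ :=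
  Iff.rfl

/-- Unfolding of `commTwistDim`. [folklore] -/
theorem commTwistDim_def : commTwistDim c = sInf (commTwistDims c) := rfl

/-! ### Every realisation bounds the twisting dimension -/

/-- A realisation in the universe of `k` has its dimension in `commTwistDims c`. [folklore] -/
theorem finrank_mem_commTwistDims {R : Type u} [CommRing R] [Algebra k R] [Module.Finite k R]
    (u : ι → ι → R) (ℓ : R →ₗ[k] k) (h : ∀ σ : Equiv.Perm ι, ℓ (∏ i, u (σ i) i) = c σ) :
    Module.finrank k R ∈ commTwistDims c :=
  ⟨R, inferInstance, inferInstance, inferInstance, u, ℓ, rfl, h⟩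

/-- Universe transport: a realisation over a commutative finite-dimensional `k`-algebra `R` in
ANY universe has its dimension in `commTwistDims c` — `R` is a quotient of some
`MvPolynomial (Fin m) k`, which lives in the universe of `k`. [folklore] -/
theorem finrank_mem_commTwistDims' {R : Type w} [CommRing R] [Algebra k R] [Module.Finite k R]
    (u : ι → ι → R) (ℓ : R →ₗ[k] k) (h : ∀ σ : Equiv.Perm ι, ℓ (∏ i, u (σ i) i) = c σ) :
    Module.finrank k R ∈ commTwistDims c := by
  obtain ⟨m, f, hf⟩ :=
    (Algebra.FiniteType.iff_quotient_mvPolynomial'' (R := k) (S := R)).1 inferInstance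
  let e := Ideal.quotientKerAlgEquivOfSurjective hf
  haveI : Module.Finite k (MvPolynomial (Fin m) k ⧸ RingHom.ker f) :=
    Module.Finite.equiv e.symm.toLinearEquiv
  refine ⟨MvPolynomial (Fin m) k ⧸ RingHom.ker f, inferInstance, inferInstance, inferInstance,
    fun i j => e.symm (u i j), ℓ ∘ₗ e.toLinearMap, e.toLinearEquiv.finrank_eq, fun σ => ?_⟩
  simp [map_prod, h σ]

/-- Every commutative realisation (in any universe) bounds the twisting dimension from above.
[folklore] -/
theorem commTwistDim_le_finrank {R : Type w} [CommRing R] [Algebra k R] [Module.Finite k R]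
    (u : ι → ι → R) (ℓ : R →ₗ[k] k) (h : ∀ σ : Equiv.Perm ι, ℓ (∏ i, u (σ i) i) = c σ) :
    commTwistDim c ≤ Module.finrank k R :=
  Nat.sInf_le (finrank_mem_commTwistDims' c u ℓ h)

/-! ### Semisimple realisations: sums of transversal product patterns -/

/-- **Semisimple realisations.** If `c` is a linear combination of `card T` transversal product
patterns `σ ↦ ∏ i, E t (σ i) i`, then `card T ∈ commTwistDims c`: realise over the product
algebra `R = (T → k)` with `u i j = (E t i j)_t` and `ℓ f = ∑ t, a t * f t`. [folklore] -/
theorem card_mem_commTwistDims_of_eq_sum {T : Type w} [Fintype T] (a : T → k)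
    (E : T → ι → ι → k) (hc : ∀ σ : Equiv.Perm ι, c σ = ∑ t, a t * ∏ i, E t (σ i) i) :
    Fintype.card T ∈ commTwistDims c := by
  classical
  have h := finrank_mem_commTwistDims' c (R := T → k) (fun i j t => E t i j)
    (∑ t, a t • (LinearMap.proj t : (T → k) →ₗ[k] k)) (fun σ => ?_)
  · rwa [Module.finrank_fintype_fun_eq_card] at h
  · rw [hc σ, LinearMap.sum_apply]
    refine Finset.sum_congr rfl fun t _ => ?_
    simp [Finset.prod_apply]

/-- **Semisimple upper bound**: a linear combination of `card T` transversal product patterns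
has `commTwistDim ≤ card T`. For the sign pattern the least such `card T` is the
"twisted determinantal rank" of the permanent, which therefore bounds `perTwistDim` above.
[folklore] -/
theorem commTwistDim_le_card_of_eq_sum {T : Type w} [Fintype T] (a : T → k)
    (E : T → ι → ι → k) (hc : ∀ σ : Equiv.Perm ι, c σ = ∑ t, a t * ∏ i, E t (σ i) i) :
    commTwistDim c ≤ Fintype.card T :=
  Nat.sInf_le (card_mem_commTwistDims_of_eq_sum c a E hc)

/-- The set of realisable dimensions is never empty: `card (Perm ι) ∈ commTwistDims c`, by the
semisimple realisation over `Perm ι → k` with `u i j = (𝟙[i = τ j])_τ`, whose transversal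
products are the indicators `𝟙[σ = τ]`, and `ℓ f = ∑ τ, c τ * f τ`. [folklore] -/
theorem card_perm_mem_commTwistDims [DecidableEq ι] :
    Fintype.card (Equiv.Perm ι) ∈ commTwistDims c := by
  refine card_mem_commTwistDims_of_eq_sum c c (fun τ i j => if i = τ j then 1 else 0)
    fun σ => ?_
  have key : ∀ τ : Equiv.Perm ι,
      (∏ i, (if σ i = τ i then (1 : k) else 0)) = if σ = τ then 1 else 0 := by
    intro τ
    rw [Fintype.prod_boole]
    by_cases hστ : σ = τ
    · simp [hστ]
    · rw [if_neg hστ, if_neg]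
      exact fun h' => hστ (Equiv.ext h')
  simp_rw [key]
  rw [Finset.sum_mul_boole]
  simp

/-- `commTwistDims c` is nonempty, so `commTwistDim c = sInf _` is attained. [folklore] -/
theorem commTwistDims_nonempty : (commTwistDims c).Nonempty := by
  classical
  exact ⟨_, card_perm_mem_commTwistDims c⟩

/-- `commTwistDim c ≤ card (Perm ι) = (card ι)!`. [folklore] -/
theorem commTwistDim_le_card_perm [DecidableEq ι] :
    commTwistDim c ≤ Fintype.card (Equiv.Perm ι) :=
  Nat.sInf_le (card_perm_mem_commTwistDims c)

/-- `commTwistDim c ≤ (card ι)!`. [folklore] -/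
theorem commTwistDim_le_factorial [DecidableEq ι] :
    commTwistDim c ≤ (Fintype.card ι).factorial := by
  simpa [Fintype.card_perm] using commTwistDim_le_card_perm c

/-- **The infimum is attained**: some commutative realisation of `c` has dimension exactly
`commTwistDim c`. [folklore] -/
theorem exists_finrank_eq_commTwistDim :
    ∃ (R : Type u) (_ : CommRing R) (_ : Algebra k R) (_ : Module.Finite k R)
      (u : ι → ι → R) (ℓ : R →ₗ[k] k),
      Module.finrank k R = commTwistDim c ∧ ∀ σ : Equiv.Perm ι, ℓ (∏ i, u (σ i) i) = c σ :=
  Nat.sInf_mem (commTwistDims_nonempty c)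

/-- `commTwistDim c ≤ s` iff some commutative realisation of `c` has dimension `≤ s` (the shape
in which upper bounds — Grassmann, semisimple, simulation cost — are usually stated). [folklore] -/
theorem commTwistDim_le_iff (s : ℕ) :
    commTwistDim c ≤ s ↔ ∃ (R : Type u) (_ : CommRing R) (_ : Algebra k R)
      (_ : Module.Finite k R) (u : ι → ι → R) (ℓ : R →ₗ[k] k),
      Module.finrank k R ≤ s ∧ ∀ σ : Equiv.Perm ι, ℓ (∏ i, u (σ i) i) = c σ := by
  constructor
  · intro hs
    obtain ⟨R, _, _, _, u, ℓ, hd, hu⟩ := exists_finrank_eq_commTwistDim c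
    exact ⟨R, inferInstance, inferInstance, inferInstance, u, ℓ, hd ▸ hs, hu⟩
  · rintro ⟨R, _, _, _, u, ℓ, hd, hu⟩
    exact (commTwistDim_le_finrank c u ℓ hu).trans hd

/-- `s < commTwistDim c` iff every commutative realisation of `c` has dimension `> s` (the shape
in which lower bounds are usually stated). [folklore] -/
theorem lt_commTwistDim_iff (s : ℕ) :
    s < commTwistDim c ↔ ∀ (R : Type u) [CommRing R] [Algebra k R] [Module.Finite k R]
      (u : ι → ι → R) (ℓ : R →ₗ[k] k),
      (∀ σ : Equiv.Perm ι, ℓ (∏ i, u (σ i) i) = c σ) → s < Module.finrank k R := by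
  constructor
  · intro hs R _ _ _ u ℓ hu
    exact hs.trans_le (commTwistDim_le_finrank c u ℓ hu)
  · intro H
    obtain ⟨R, _, _, _, u, ℓ, hd, hu⟩ := exists_finrank_eq_commTwistDim c
    exact hd ▸ H R u ℓ hu

/-! ### Dimension `0` and dimension `1` -/

/-- `commTwistDim c = 0 ↔ c = 0`: the zero algebra (the only one of dimension `0`) realises
exactly the zero pattern. [folklore] -/
theorem commTwistDim_eq_zero_iff : commTwistDim c = 0 ↔ c = 0 := by
  constructor
  · intro h0
    obtain ⟨R, _, _, _, u, ℓ, hd, hu⟩ := exists_finrank_eq_commTwistDim c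
    rw [h0] at hd
    have hR : ∀ x : R, x = 0 := finrank_zero_iff_forall_zero.1 hd
    funext σ
    rw [← hu σ, hR (∏ i, u (σ i) i), map_zero, Pi.zero_apply]
  · rintro rfl
    have h := commTwistDim_le_finrank (0 : Equiv.Perm ι → k) (R := PUnit.{u + 1})
      (fun _ _ => 0) 0 (fun σ => by simp)
    simpa [Module.finrank_zero_of_subsingleton] using h

/-- **Dimension at most one** (`R = k`, Pólya's scalar twists): `commTwistDim c ≤ 1` iff `c` is
a scalar multiple of a transversal product pattern `σ ↦ ∏ i, E (σ i) i`. (The scalar absorbs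
into `E` when `ι` is nonempty, `commTwistDim_le_one_iff'`; it is needed for `ι` empty and for
`c = 0`.) [folklore] -/
theorem commTwistDim_le_one_iff :
    commTwistDim c ≤ 1 ↔ ∃ (a : k) (E : ι → ι → k), ∀ σ : Equiv.Perm ι,
      c σ = a * ∏ i, E (σ i) i := by
  constructor
  · intro h1
    obtain ⟨R, _, _, _, u, ℓ, hd, hu⟩ := exists_finrank_eq_commTwistDim c
    rcases Nat.le_one_iff_eq_zero_or_eq_one.1 h1 with h0 | h0
    · have hc : c = 0 := (commTwistDim_eq_zero_iff c).1 h0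
      exact ⟨0, fun _ _ => 0, fun σ => by simp [hc]⟩
    · rw [h0] at hd
      haveI : Nontrivial R := Module.nontrivial_of_finrank_eq_succ hd
      have hspan := (finrank_eq_one_iff_of_nonzero' (1 : R) one_ne_zero).1 hd
      choose E hE using fun i j => hspan (u i j)
      refine ⟨ℓ 1, E, fun σ => ?_⟩
      rw [← hu σ]
      have : (∏ i, u (σ i) i) = (∏ i, E (σ i) i) • (1 : R) := by
        simp_rw [← hE, Algebra.smul_def, mul_one, ← map_prod]
      rw [this, map_smul, smul_eq_mul, mul_comm]
  · rintro ⟨a, E, hE⟩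
    simpa using commTwistDim_le_card_of_eq_sum c (T := Fin 1) (fun _ => a) (fun _ => E)
      (fun σ => by simp [hE σ])

/-- For a nonempty index type the scalar in `commTwistDim_le_one_iff` absorbs into one column of
`E`: `commTwistDim c ≤ 1 ↔ c` is a transversal product pattern. [folklore] -/
theorem commTwistDim_le_one_iff' [Nonempty ι] :
    commTwistDim c ≤ 1 ↔ ∃ E : ι → ι → k, ∀ σ : Equiv.Perm ι, c σ = ∏ i, E (σ i) i := by
  classical
  rw [commTwistDim_le_one_iff]
  constructor
  · rintro ⟨a, E, hE⟩
    obtain ⟨i₀⟩ := ‹Nonempty ι›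
    refine ⟨fun x y => (if y = i₀ then a else 1) * E x y, fun σ => ?_⟩
    rw [Finset.prod_mul_distrib, Fintype.prod_ite_eq', hE σ]
  · rintro ⟨E, hE⟩
    exact ⟨1, E, fun σ => by rw [one_mul, hE σ]⟩

/-! ### Monotonicity in `n`: fixing a point -/

/-- **Monotone in `n`.** Restricting a pattern on `Fin (n+1)` to the permutations fixing `0`
(`τ ↦ decomposeFin.symm (0, τ)`, i.e. `0 ↦ 0`, `i.succ ↦ (τ i).succ`) does not increase the
twisting dimension: keep `R`, use the twists `u i.succ j.succ` and the functional
`r ↦ ℓ (r * u 0 0)`. [folklore] -/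
theorem commTwistDim_fixZero_le {n : ℕ} (c : Equiv.Perm (Fin (n + 1)) → k) :
    commTwistDim (fun τ : Equiv.Perm (Fin n) => c (Equiv.Perm.decomposeFin.symm (0, τ))) ≤
      commTwistDim c := by
  obtain ⟨R, _, _, _, u, ℓ, hd, hu⟩ := exists_finrank_eq_commTwistDim c
  rw [← hd]
  refine commTwistDim_le_finrank _ (fun i j => u i.succ j.succ)
    (ℓ ∘ₗ LinearMap.mulRight k (u 0 0)) fun τ => ?_
  rw [← hu]
  simp only [LinearMap.coe_comp, Function.comp_apply, LinearMap.mulRight_apply]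
  congr 1
  rw [Fin.prod_univ_succ, mul_comm]
  simp

/-- The sign pattern restricted to the permutations fixing `0` is the sign pattern. [folklore] -/
theorem intCast_sign_decomposeFin_symm_zero {n : ℕ} (τ : Equiv.Perm (Fin n)) :
    (((Equiv.Perm.sign (Equiv.Perm.decomposeFin.symm (0, τ)) : ℤ) : k)) =
      ((Equiv.Perm.sign τ : ℤ) : k) := by
  rw [Equiv.Perm.decomposeFin.symm_sign, if_pos rfl, one_mul]

/-- `s(n) ≤ s(n+1)` for the twisting dimension of the permanent. [folklore] -/
theorem perTwistDim_le_succ (n : ℕ) : perTwistDim k n ≤ perTwistDim k (n + 1) := by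
  have h := commTwistDim_fixZero_le (k := k)
    (fun σ : Equiv.Perm (Fin (n + 1)) => ((Equiv.Perm.sign σ : ℤ) : k))
  simp only [intCast_sign_decomposeFin_symm_zero] at h
  exact h

/-- The twisting dimension of the permanent is monotone in `n`. [folklore] -/
theorem perTwistDim_mono : Monotone (perTwistDim k) :=
  monotone_nat_of_le_succ perTwistDim_le_succ

/-! ### Sums and external tensors of patterns -/

/-- **Sub-additivity**: `commTwistDim (c + c') ≤ commTwistDim c + commTwistDim c'`, by the
product algebra `R × R'` with twists `(u, u')` and functional `ℓ ∘ fst + ℓ' ∘ snd`. [folklore] -/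
theorem commTwistDim_add_le (c' : Equiv.Perm ι → k) :
    commTwistDim (c + c') ≤ commTwistDim c + commTwistDim c' := by
  obtain ⟨R, _, _, _, u, ℓ, hd, hu⟩ := exists_finrank_eq_commTwistDim c
  obtain ⟨R', _, _, _, u', ℓ', hd', hu'⟩ := exists_finrank_eq_commTwistDim c'
  rw [← hd, ← hd', ← Module.finrank_prod]
  refine commTwistDim_le_finrank _ (fun i j => (u i j, u' i j))
    (ℓ ∘ₗ LinearMap.fst k R R' + ℓ' ∘ₗ LinearMap.snd k R R') fun σ => ?_
  simp [Prod.fst_prod, Prod.snd_prod, hu σ, hu' σ]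

/-- **Sub-multiplicativity on a Young subgroup.** Let `c` be a pattern on `ι ⊕ κ` which is the
external tensor of `c₁` and `c₂`: `c (σ₁ ⊕ σ₂) = c₁ σ₁ * c₂ σ₂` on the Young subgroup
`Perm ι × Perm κ` and `c σ = 0` off it. Then `commTwistDim c ≤ commTwistDim c₁ * commTwistDim c₂`,
by the tensor product `R₁ ⊗[k] R₂` with block-diagonal twists `u₁ ⊗ 1`, `1 ⊗ u₂` (and `0` off
the diagonal blocks) and the functional `ℓ₁ ⊗ ℓ₂`. [folklore] -/
theorem commTwistDim_sum_le {κ : Type w} [Fintype κ] (c₁ : Equiv.Perm ι → k)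
    (c₂ : Equiv.Perm κ → k) (c : Equiv.Perm (ι ⊕ κ) → k)
    (hon : ∀ (σ₁ : Equiv.Perm ι) (σ₂ : Equiv.Perm κ), c (σ₁.sumCongr σ₂) = c₁ σ₁ * c₂ σ₂)
    (hoff : ∀ σ : Equiv.Perm (ι ⊕ κ), σ ∉ (Equiv.Perm.sumCongrHom ι κ).range → c σ = 0) :
    commTwistDim c ≤ commTwistDim c₁ * commTwistDim c₂ := by
  classical
  obtain ⟨R₁, _, _, _, u₁, ℓ₁, hd₁, hu₁⟩ := exists_finrank_eq_commTwistDim c₁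
  obtain ⟨R₂, _, _, _, u₂, ℓ₂, hd₂, hu₂⟩ := exists_finrank_eq_commTwistDim c₂
  rw [← hd₁, ← hd₂, ← Module.finrank_tensorProduct]
  let u : ι ⊕ κ → ι ⊕ κ → TensorProduct k R₁ R₂ := fun x y =>
    match x, y with
    | Sum.inl i, Sum.inl j => u₁ i j ⊗ₜ[k] 1
    | Sum.inr i, Sum.inr j => (1 : R₁) ⊗ₜ[k] u₂ i j
    | Sum.inl _, Sum.inr _ => 0
    | Sum.inr _, Sum.inl _ => 0
  let ℓ : TensorProduct k R₁ R₂ →ₗ[k] k :=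
    (TensorProduct.lid k k).toLinearMap ∘ₗ TensorProduct.map ℓ₁ ℓ₂
  have hℓ : ∀ (a : R₁) (b : R₂), ℓ (a ⊗ₜ[k] b) = ℓ₁ a * ℓ₂ b := fun a b => by
    simp [ℓ]
  refine commTwistDim_le_finrank c u ℓ fun σ => ?_
  by_cases hσ : σ ∈ (Equiv.Perm.sumCongrHom ι κ).range
  · obtain ⟨⟨σ₁, σ₂⟩, rfl⟩ := MonoidHom.mem_range.1 hσ
    rw [Equiv.Perm.sumCongrHom_apply, hon, Fintype.prod_sum_type]
    simp only [Equiv.sumCongr_apply, Sum.map_inl, Sum.map_inr, u]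
    have h1 : (∏ i, u₁ (σ₁ i) i ⊗ₜ[k] (1 : R₂)) = (∏ i, u₁ (σ₁ i) i) ⊗ₜ[k] 1 := by
      have := map_prod (Algebra.TensorProduct.includeLeft (R := k) (S := k) (A := R₁)
        (B := R₂)) (fun i => u₁ (σ₁ i) i) Finset.univ
      simpa only [Algebra.TensorProduct.includeLeft_apply] using this.symm
    have h2 : (∏ j, (1 : R₁) ⊗ₜ[k] u₂ (σ₂ j) j) = (1 : R₁) ⊗ₜ[k] ∏ j, u₂ (σ₂ j) j := by
      have := map_prod (Algebra.TensorProduct.includeRight (R := k) (A := R₁) (B := R₂))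
        (fun j => u₂ (σ₂ j) j) Finset.univ
      simpa only [Algebra.TensorProduct.includeRight_apply] using this.symm
    rw [h1, h2, Algebra.TensorProduct.tmul_mul_tmul, mul_one, one_mul, hℓ, hu₁, hu₂]
  · rw [hoff σ hσ]
    have h1 : ¬ Set.MapsTo σ (Set.range Sum.inl) (Set.range Sum.inl) :=
      mt Equiv.Perm.mem_sumCongrHom_range_of_perm_mapsTo_inl hσ
    simp only [Set.MapsTo, Set.mem_range, forall_exists_index, forall_apply_eq_imp_iff,
      not_forall, not_exists] at h1
    obtain ⟨a, ha⟩ := h1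
    have hz : u (σ (Sum.inl a)) (Sum.inl a) = 0 := by
      rcases hx : σ (Sum.inl a) with a₂ | b
      · exact absurd hx.symm (ha a₂)
      · rfl
    rw [Finset.prod_eq_zero (f := fun x => u (σ x) x) (Finset.mem_univ (Sum.inl a)) hz,
      map_zero]

/-! ### Invariances -/

/-- Relabeling rows and columns: `σ ↦ c (π * σ * ρ)` is realised in the same dimension as `c`
(twists `u (π i) (ρ⁻¹ j)`). [folklore] -/
theorem commTwistDim_relabel_le (π ρ : Equiv.Perm ι) :
    commTwistDim (fun σ => c (π * σ * ρ)) ≤ commTwistDim c := by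
  obtain ⟨R, _, _, _, u, ℓ, hd, hu⟩ := exists_finrank_eq_commTwistDim c
  rw [← hd]
  refine commTwistDim_le_finrank _ (fun i j => u (π i) (ρ.symm j)) ℓ fun σ => ?_
  rw [← hu (π * σ * ρ)]
  congr 1
  rw [← Equiv.prod_comp ρ (fun j => u (π (σ j)) (ρ.symm j))]
  simp [Equiv.Perm.mul_apply]

/-- **Invariance under relabelings** `σ ↦ π σ ρ` of `Perm ι` (row and column permutations).
[folklore] -/
theorem commTwistDim_relabel (π ρ : Equiv.Perm ι) :
    commTwistDim (fun σ => c (π * σ * ρ)) = commTwistDim c := by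
  refine le_antisymm (commTwistDim_relabel_le c π ρ) ?_
  have h := commTwistDim_relabel_le (fun σ => c (π * σ * ρ)) π⁻¹ ρ⁻¹
  simp only [mul_assoc, mul_inv_cancel_left, inv_mul_cancel, mul_one] at h
  simpa [mul_assoc] using h

/-- Reindexing along `e : ι ≃ κ`: the pattern `σ ↦ c (e.permCongr σ)` on `ι` is realised in the
same dimension as `c` on `κ` (twists `u (e i) (e j)`). [folklore] -/
theorem commTwistDim_reindex_le {κ : Type w} [Fintype κ] (e : ι ≃ κ) (c : Equiv.Perm κ → k) :
    commTwistDim (fun σ : Equiv.Perm ι => c (e.permCongr σ)) ≤ commTwistDim c := by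
  obtain ⟨R, _, _, _, u, ℓ, hd, hu⟩ := exists_finrank_eq_commTwistDim c
  rw [← hd]
  refine commTwistDim_le_finrank _ (fun i j => u (e i) (e j)) ℓ fun σ => ?_
  rw [← hu (e.permCongr σ), ← Equiv.prod_comp e (fun x => u (e.permCongr σ x) x)]
  simp [Equiv.permCongr_apply]

/-- **Invariance under reindexing** along `e : ι ≃ κ` (e.g. `finSumFinEquiv` to pass between
`Fin m ⊕ Fin n` and `Fin (m + n)`). [folklore] -/
theorem commTwistDim_reindex {κ : Type w} [Fintype κ] (e : ι ≃ κ) (c : Equiv.Perm κ → k) :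
    commTwistDim (fun σ : Equiv.Perm ι => c (e.permCongr σ)) = commTwistDim c := by
  refine le_antisymm (commTwistDim_reindex_le e c) ?_
  have h := commTwistDim_reindex_le e.symm (fun σ : Equiv.Perm ι => c (e.permCongr σ))
  have key : (fun σ : Equiv.Perm κ => c (e.permCongr (e.symm.permCongr σ))) = c := by
    funext σ; congr 1; ext x; simp [Equiv.permCongr_apply]
  simpa [key] using h

/-- **Hadamard twisting by a transversal product pattern** does not increase the dimension:
`σ ↦ (∏ i, E (σ i) i) * c σ` is realised by the twists `E i j • u i j` over the same `R`; for
nowhere-zero `E` (the torus) this is an invariance, `commTwistDim_hadamard_eq`. [folklore] -/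
theorem commTwistDim_hadamard_le (E : ι → ι → k) :
    commTwistDim (fun σ => (∏ i, E (σ i) i) * c σ) ≤ commTwistDim c := by
  obtain ⟨R, _, _, _, u, ℓ, hd, hu⟩ := exists_finrank_eq_commTwistDim c
  rw [← hd]
  refine commTwistDim_le_finrank _ (fun i j => E i j • u i j) ℓ fun σ => ?_
  rw [Finset.prod_smul, map_smul, hu σ, smul_eq_mul]

/-- Invariance under the torus: Hadamard twisting by a nowhere-zero transversal product pattern
preserves the twisting dimension. [folklore] -/
theorem commTwistDim_hadamard_eq (E : ι → ι → k) (hE : ∀ i j, E i j ≠ 0) :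
    commTwistDim (fun σ => (∏ i, E (σ i) i) * c σ) = commTwistDim c := by
  refine le_antisymm (commTwistDim_hadamard_le c E) ?_
  have h : commTwistDim (fun σ : Equiv.Perm ι => (∏ i, (E (σ i) i)⁻¹) * ((∏ i, E (σ i) i) * c σ))
      ≤ commTwistDim (fun σ => (∏ i, E (σ i) i) * c σ) :=
    commTwistDim_hadamard_le (fun σ => (∏ i, E (σ i) i) * c σ) (fun i j => (E i j)⁻¹)
  have key : (fun σ : Equiv.Perm ι => (∏ i, (E (σ i) i)⁻¹) * ((∏ i, E (σ i) i) * c σ)) = c := by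
    funext σ
    rw [← mul_assoc, ← Finset.prod_mul_distrib, Finset.prod_eq_one fun i _ => ?_, one_mul]
    exact inv_mul_cancel₀ (hE _ _)
  rwa [key] at h

/-! ### The twisted determinant -/

/-- Coefficients of a generalized matrix function `∑_σ f(σ) ∏ᵢ X_{σ i, i}`: the coefficient of the
monomial `m` is the sum of `f σ` over the `σ` with exponent vector `∑ i, e_{(σ i, i)} = m` (at most
one such `σ`). [folklore] -/
theorem coeff_sum_C_mul_prod_X [DecidableEq ι] {S : Type w} [CommSemiring S]
    (f : Equiv.Perm ι → S) (m : ι × ι →₀ ℕ) :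
    coeff m (∑ σ : Equiv.Perm ι, C (f σ) * ∏ i, (X (σ i, i) : MvPolynomial (ι × ι) S)) =
      ∑ σ : Equiv.Perm ι, if (∑ i, Finsupp.single (σ i, i) 1) = m then f σ else 0 := by
  rw [coeff_sum]
  refine Finset.sum_congr rfl fun σ _ => ?_
  have hX : (∏ i, (X (σ i, i) : MvPolynomial (ι × ι) S)) =
      monomial (∑ i, Finsupp.single (σ i, i) 1) 1 := by
    rw [monomial_sum_one]
    rfl
  rw [hX, coeff_C_mul, coeff_monomial]
  split_ifs <;> simp

/-- **The twisted determinant formula.** If `(R, u, ℓ)` realises `c`, then `ℓ` applied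
coefficientwise to the ONE determinant `det (X_{ij} · u_{ij})` over `MvPolynomial (ι × ι) R`
gives the sign-twisted generalized matrix function `∑_σ sgn(σ) c(σ) ∏ᵢ X_{σ i, i}` of `c` over
`k`; for `c = sgn` the right-hand side is the permanent `∑_σ ∏ᵢ X_{σ i, i}` (Marcus–Minc 1961 treat
`R = k`). [folklore] -/
theorem linearMap_coeff_det_twist [DecidableEq ι] {R : Type w} [CommRing R] [Algebra k R]
    (u : ι → ι → R) (ℓ : R →ₗ[k] k) (h : ∀ σ : Equiv.Perm ι, ℓ (∏ i, u (σ i) i) = c σ)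
    (m : ι × ι →₀ ℕ) :
    ℓ (coeff m (Matrix.det (Matrix.of fun i j : ι =>
        (X (i, j) : MvPolynomial (ι × ι) R) * C (u i j)))) =
      coeff m (∑ σ : Equiv.Perm ι,
        C (((Equiv.Perm.sign σ : ℤ) : k) * c σ) * ∏ i, (X (σ i, i) : MvPolynomial (ι × ι) k)) := by
  have hdet : Matrix.det (Matrix.of fun i j : ι => (X (i, j) : MvPolynomial (ι × ι) R) * C (u i j))
      = ∑ σ : Equiv.Perm ι, C (((Equiv.Perm.sign σ : ℤ) : R) * ∏ i, u (σ i) i) *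
          ∏ i, (X (σ i, i) : MvPolynomial (ι × ι) R) := by
    rw [Matrix.det_apply]
    refine Finset.sum_congr rfl fun σ _ => ?_
    simp only [Matrix.of_apply, Finset.prod_mul_distrib, ← map_prod C, Units.smul_def,
      zsmul_eq_mul, map_mul, map_intCast]
    ring
  rw [hdet, coeff_sum_C_mul_prod_X, coeff_sum_C_mul_prod_X, map_sum]
  refine Finset.sum_congr rfl fun σ _ => ?_
  split_ifs
  · rw [← h σ, ← zsmul_eq_mul, map_zsmul, zsmul_eq_mul]
  · exact map_zero ℓ

end Literature.Computability.AlgebraicComplexity
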